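import Mathlib
import HarnessLib
import Literature.NumberTheory.LFunctions.XiHigherDerivativesCriticalStrip
import Summits.RiemannHypothesis.RiemannHypothesis.Theorems.EarlyAppointmentsRemainder0XiFarAbelSkeleton
import Summits.RiemannHypothesis.RiemannHypothesis.Theorems.EarlyAppointmentsRemainder0XiHeightSumAbel
import Summits.RiemannHypothesis.RiemannHypothesis.Theorems.EarlyAppointmentsRemainder0XiKernelShiftPointwise

/-!
# ⟨24730⟩ rho2_v4 LEAF 1 — the NORM REDUCTION of the kernel shift (pair sum ↦ height sum)

C4 «kernel desk» rh-idea-6 g30 (director (CA406) order (d)). SUPPORT module: no `sorry`, standard axioms, helper namespace only.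
PRE-IMAGE: imports `…FarAbelSkeleton` (2ac71bb0: `farBoxAt`, `farPairSum`, `farHeightSum`), `…HeightSumAbel` (289ab1de: `heightBox`,
`heightBox_finite`, `zeta_zero_of_xi_zero`) and `…KernelShiftPointwise` (236ce4dc: the pointwise kernel shift) — checked as a scratch.

LEAF 1 (`KernelShiftLeaf K`) asks `‖F_T(w) − G_T(Re w)‖ ≤ K.cS·log(γ/2π) + ε` eventually in `T`.  This file does the COMPLEX ↦ REAL step:
* (`abs_im_lt_half_of_riemannXiUpper_eq_zero`, Literature): a zero `ρ` of `Ξ` has `|Im ρ| < 1/2` (open critical strip, via the dictionary `zeta_zero_of_xi_zero`);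
* `farBoxAt_finite`, `re_ne_of_mem_farBoxAt`;
* ★ `norm_farPairSum_sub_le`: `‖farPairSum w T − farHeightSum (Re w) T‖ ≤ Σᶠ_{ρ ∈ farBoxAt (Re w) T} ord(ρ)·2/(Re w − Re ρ)²` (crude kernel), and
* ★ `norm_farPairSum_sub_le_sharp`: `… ≤ Σᶠ ord(ρ)·(1/(Re w − Re ρ)² + 1/(Re w + Re ρ)²)` (sharp kernel),
for `|Im w| ≤ 1/2`, `0 < Re w` — a REAL height sum with a positive decreasing-in-distance kernel, ready for the Abel engine
(…HeightSumAbelBound `abel_bound_hsw` below `x − 67.5`, …AbelHighSide's BPT-Thm-2 form above `x + 67.5`, exactly as LEAF 2).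
What remains of LEAF 1 after this file: the two Abel passes with `φ(t) = 2/(x − t)²` (resp. the sharp kernel) and C3's pricing of `cS`.
Nothing here bears on the truth of RH; RH is not proved; 24730 OPEN.
-/

noncomputable section

set_option linter.dupNamespace false

open Literature.NumberTheory.LFunctions

namespace Summit.RiemannHypothesis.RiemannHypothesis.Theorems.EarlyAppointmentsRemainder0Xi.KernelShiftSum

open Complex
open Summit.RiemannHypothesis.RiemannHypothesis.Cruxes.Remainder0Xi.Rho2V2 (T_PT boxHalfWidth eta0)
open Summit.RiemannHypothesis.RiemannHypothesis.Theorems.EarlyAppointmentsRemainder0Xi.FarAbelSkeleton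
  (farBoxAt farPairSum farHeightSum)
open Summit.RiemannHypothesis.RiemannHypothesis.Theorems.EarlyAppointmentsRemainder0Xi.HeightSumAbel
  (heightBox heightBox_finite zeta_zero_of_xi_zero)
open Summit.RiemannHypothesis.RiemannHypothesis.Theorems.EarlyAppointmentsRemainder0Xi.KernelShiftPointwise
  (kernel_shift_pointwise_mul kernel_shift_pointwise_sharp_mul)

-- (v2, C4 g31) `|Im ρ| < 1/2` for a zero `ρ` of `Ξ` is the Literature lemma
-- `Literature.NumberTheory.LFunctions.abs_im_lt_half_of_riemannXiUpper_eq_zero` (…XiHigherDerivativesCriticalStrip, imported above,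
-- in scope through `open Literature.NumberTheory.LFunctions`); the v1 image re-proved it as `abs_im_lt_half` (dedup.landed).

/-- (K) the far box sits inside the height box `(0, T]`. -/
theorem farBoxAt_subset (x T : ℝ) : farBoxAt x T ⊆ heightBox 0 T := fun _ h ↦ ⟨h.1, h.2.1, h.2.2.1⟩

/-- (K) the far box is finite. -/
theorem farBoxAt_finite (x T : ℝ) : (farBoxAt x T).Finite := (heightBox_finite 0 T).subset (farBoxAt_subset x T)

/-- (K) a far zero does not sit at the abscissa `x`. -/
theorem re_ne_of_mem_farBoxAt {x T : ℝ} {ρ : ℂ} (h : ρ ∈ farBoxAt x T) : x ≠ ρ.re := by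
  intro e
  have h4 : boxHalfWidth ≤ |ρ.re - x| := h.2.2.2
  rw [← e, sub_self, abs_zero] at h4
  have hB : boxHalfWidth = 135 / 2 := rfl
  rw [hB] at h4
  norm_num at h4

/-- (K) the difference `F_T(w) − G_T(Re w)` as ONE finite sum of pointwise kernel shifts. -/
theorem farPairSum_sub_eq {w : ℂ} (T : ℝ) :
    farPairSum w T - (farHeightSum w.re T : ℂ) =
      ∑ ρ ∈ (farBoxAt_finite w.re T).toFinset,
        (((analyticOrderAt riemannXiUpper ρ).toNat : ℂ) * 2 * w / (w ^ 2 - ρ ^ 2)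
          - ((((analyticOrderAt riemannXiUpper ρ).toNat : ℝ) * (2 * w.re / (w.re ^ 2 - ρ.re ^ 2)) : ℝ) : ℂ)) := by
  have hfin := farBoxAt_finite w.re T
  unfold farPairSum farHeightSum
  rw [finsum_mem_eq_finite_toFinset_sum _ hfin, finsum_mem_eq_finite_toFinset_sum _ hfin, Complex.ofReal_sum,
    ← Finset.sum_sub_distrib]

/-- ★ (K) **LEAF 1, NORM REDUCTION (crude kernel)**: for `|Im w| ≤ 1/2`, `0 < Re w`,
`‖F_T(w) − G_T(Re w)‖ ≤ Σᶠ_{far ρ} ord(ρ)·2/(Re w − Re ρ)²`. -/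
theorem norm_farPairSum_sub_le {w : ℂ} (T : ℝ) (hw : |w.im| ≤ 1 / 2) (hx : 0 < w.re) :
    ‖farPairSum w T - (farHeightSum w.re T : ℂ)‖ ≤
      ∑ᶠ ρ ∈ farBoxAt w.re T, ((analyticOrderAt riemannXiUpper ρ).toNat : ℝ) * (2 / (w.re - ρ.re) ^ 2) := by
  have hfin := farBoxAt_finite w.re T
  rw [farPairSum_sub_eq, finsum_mem_eq_finite_toFinset_sum _ hfin]
  refine (norm_sum_le _ _).trans (Finset.sum_le_sum fun ρ hρ ↦ ?_)
  have hmem : ρ ∈ farBoxAt w.re T := hfin.mem_toFinset.1 hρ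
  exact kernel_shift_pointwise_mul hw (abs_im_lt_half_of_riemannXiUpper_eq_zero hmem.1).le hx hmem.2.1 (re_ne_of_mem_farBoxAt hmem)
    (analyticOrderAt riemannXiUpper ρ).toNat

/-- ★ (K) **LEAF 1, NORM REDUCTION (sharp kernel)**: `‖F_T(w) − G_T(Re w)‖ ≤ Σᶠ_{far ρ} ord(ρ)·(1/(Re w − Re ρ)² + 1/(Re w + Re ρ)²)`. -/
theorem norm_farPairSum_sub_le_sharp {w : ℂ} (T : ℝ) (hw : |w.im| ≤ 1 / 2) (hx : 0 < w.re) :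
    ‖farPairSum w T - (farHeightSum w.re T : ℂ)‖ ≤
      ∑ᶠ ρ ∈ farBoxAt w.re T, ((analyticOrderAt riemannXiUpper ρ).toNat : ℝ) *
        (1 / (w.re - ρ.re) ^ 2 + 1 / (w.re + ρ.re) ^ 2) := by
  have hfin := farBoxAt_finite w.re T
  rw [farPairSum_sub_eq, finsum_mem_eq_finite_toFinset_sum _ hfin]
  refine (norm_sum_le _ _).trans (Finset.sum_le_sum fun ρ hρ ↦ ?_)
  have hmem : ρ ∈ farBoxAt w.re T := hfin.mem_toFinset.1 hρ
  exact kernel_shift_pointwise_sharp_mul hw (abs_im_lt_half_of_riemannXiUpper_eq_zero hmem.1).le hx hmem.2.1 (re_ne_of_mem_farBoxAt hmem)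
    (analyticOrderAt riemannXiUpper ρ).toNat

/-- (K) the box hypotheses of LEAF 1 give the two side conditions: `|Im w| ≤ eta0 = 1/2` is literal and `0 < Re w` follows from
`|Re w − γ| ≤ 67.5`, `γ > T_PT`. -/
theorem re_pos_of_box {γ : ℝ} {w : ℂ} (hγ : T_PT < γ) (hw : |w.re - γ| ≤ boxHalfWidth) : 0 < w.re := by
  have h1 := (abs_le.1 hw).1
  have hT : T_PT = 3000175332800 := rfl
  have hB : boxHalfWidth = 135 / 2 := rfl
  rw [hT] at hγ
  rw [hB] at h1
  linarith

/-- ★ (K) **LEAF 1 REDUCED TO A REAL HEIGHT-SUM BOUND**: if the far height sum with kernel `2/(x − Re ρ)²` is eventually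
`≤ K.cS·log(γ/2π) + ε` on the box, then `KernelShiftLeaf K` holds. (The successor proves the hypothesis with the Abel engine.) -/
theorem kernelShiftLeaf_of_heightBound (K : FarAbelSkeleton.LeafConsts)
    (h : ∀ γ : ℝ, T_PT < γ → ∀ x : ℝ, |x - γ| ≤ boxHalfWidth → ∀ ε : ℝ, 0 < ε → ∀ᶠ T : ℝ in Filter.atTop,
      ∑ᶠ ρ ∈ farBoxAt x T, ((analyticOrderAt riemannXiUpper ρ).toNat : ℝ) * (2 / (x - ρ.re) ^ 2)
        ≤ K.cS * Real.log (γ / (2 * Real.pi)) + ε) :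
    FarAbelSkeleton.KernelShiftLeaf K := by
  intro γ hγ w hw hη _ ε hε
  have hx : 0 < w.re := re_pos_of_box hγ hw
  have hE : eta0 = 1 / 2 := rfl
  rw [hE] at hη
  filter_upwards [h γ hγ w.re hw ε hε] with T hT
  exact (norm_farPairSum_sub_le T hη hx).trans hT

end Summit.RiemannHypothesis.RiemannHypothesis.Theorems.EarlyAppointmentsRemainder0Xi.KernelShiftSum
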